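import Literature.NumberTheory.Automorphic.PairLFunctionMeromorphicContinuationNeConjLocalReduction
import HarnessLib

/-!
# `L^S(s, π × σ)` is entire for ORTHOGONAL pairs `π ⟂ σ̄`, from the local Rankin–Selberg theory —
# Mœglin–Waldspurger (i)(b) without multiplicity one (proofs only)

Topic `NumberTheory/Automorphic`; namespace `Literature.NumberTheory.Automorphic`. Proof file (theorems
only: no definition, no named fact, no instance), companion of
`PairLFunctionMeromorphicContinuationNeConjLocalReduction` under the named fact
`MoeglinWaldspurger1989_partialPairL_entire_of_ne_conj` (Mœglin–Waldspurger (1989), Appendice,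
Corollaire (i)(b), p. 667: for unitary cuspidal `ρ ≇ ρ̌'[t]` on `GL(n, 𝔸)`, `L(s, ρ × ρ')` is entire) and,
through `PairLFunctionPolesRepDataSchur`, under `JacquetShalika1981_partialPairL_boundary_repData`
(Arthur–Clozel (1989), Ch. 3, (2.2)).

The printed proof (Jacquet–Shalika (1981), §4; Cogdell (2004), §2.3 and §4.2, proof of Thm. 4.2) uses
the hypothesis `π ≇ σ̃` at exactly two points: the residues of the global Rankin–Selberg integrals
`I(s; φ̄', φ, Φ)` at `s = 1` and at `s = 0` are multiples of `∫ φ̄' φ = ⟨φ', φ⟩`, which vanishes because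
**`π` and `σ̄` are orthogonal**. The tree's rendering of "`π ≇ σ̃`" in the named fact is "`P ≠ P'.conj`
together with `multiplicity_one_gl`", and `MoeglinWaldspurger1989_partialPairL_entire_of_ne_conj_of_local`
accordingly derives the orthogonality from multiplicity one (`CuspidalAutomorphicRepGL.isOrtho_of_ne`).
This file runs the same reduction with the ORTHOGONALITY `π ⟂ σ̄` as the hypothesis, so that no
multiplicity one is involved anywhere:

* `integral_mul_eq_zero_of_isOrtho_conj` — `∫ φ φ' dμ = ⟨φ̄, φ'⟩ = 0` for cusp forms `φ ∈ π`, `φ' ∈ σ`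
  with `π̄ ⟂ σ`;
* `tendsto_sub_one_mul_rankinSelbergIntegral_of_isOrtho_conj` — then `(s - 1) I(s; φ, φ', Φ) → 0` at
  `s = 1` (`tendsto_sub_one_mul_rankinSelbergIntegral`: the residue is `c_D V Φ̂(0)/n · ∫ φ φ'`);
* `apply_one_eq_zero_of_entire_eq_mul_rankinSelbergIntegral_of_isOrtho`,
  `apply_zero_eq_zero_of_entire_eq_mul_rankinSelbergIntegral_of_isOrtho` — every entire `F` with
  `F(s) = s (s - 1) I(s; S̄_η f', S_η f, Φ)` on `Re s > 1`, `f ∈ π`, `f' ∈ π'`, `π' ⟂ π`, has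
  `F(1) = 0` and `F(0) = 0` (the latter through the explicit continuation of
  `RankinSelbergIntegralEntireZero`, whose value at `0` is `V Φ(0)/n · ∫ S̄_η f' S_η f`; Jacquet–Shalika
  (1981), §4, Lemma 4.2);
* `partialPairL_entire_of_isOrtho_conj_of_local` (**main**) — **for cuspidal `π`, `σ` in one
  `L²_cusp(GL_n, μ)` with `π ⟂ σ̄`, `L^S(s, π ⊗ σ)` extends to an entire function** (every finite `S`,
  all Satake families off `S`), from the global Rankin–Selberg theorems of the tree
  (`exists_entire_eq_mul_partialPairL_mul_setIntegral_pair`) and the same two explicit inputs as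
  `…_of_local` — `hloc`, the LOCAL theory (finitely many data whose normalised `S'`-parts sum, on the
  strip `1 < Re s < 2`, to a function with an entire reciprocal; Jacquet–Piatetski-Shapiro–Shalika
  (1983), §2, Thm. 2.7, Jacquet–Shalika (1981), §1, §3), and `htw`, the conclusion for the pairs without
  a common central action (twisted mirabolic Eisenstein series, Cogdell §2.3) — in which the binder
  `multiplicity_one_gl n K μ'` is REPLACED by the orthogonality `P.1.toSubmodule ⟂ P'.conj.1.toSubmodule`
  (the binder `P ≠ P'.conj` is kept: orthogonal representations are distinct). A local theorem proved
  without recourse to multiplicity one discharges both forms.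

This is the input `(hB)` of `JacquetShalika1981_partialPairL_boundary_repData_of_moeglinWaldspurger_of_isOrtho`
(`PairLFunctionPolesRepDataSchur`): with it, Arthur–Clozel (2.2) for Borel–Jacquet data rests on
Mœglin–Waldspurger (i)(a), (ii), `hloc` and `htw` — and not on `multiplicity_one_gl`.

## References

* C. Mœglin, J.-L. Waldspurger, *Le spectre résiduel de GL(n)*, Ann. Sci. ÉNS 22 (1989), Appendice,
  Corollaire (i)(b), p. 667 [MoeglinWaldspurger1989].
* J. W. Cogdell, *Analytic theory of L-functions for GL_n*, in *An Introduction to the Langlands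
  Program* (2004), §2.3, §3, §4.2 [CogdellAnalyticTheory2004].
* H. Jacquet, J. A. Shalika, *On Euler products and the classification of automorphic
  representations I, II*, Amer. J. Math. 103 (1981), I §4 Lemma 4.2, II Prop. 3.6 [JacquetShalikaAJM1981].
* A. Deitmar, S. Echterhoff, *Principles of Harmonic Analysis*, 2nd ed. (2014), Cor. 6.1.9 (Schur
  orthogonality, the source of the hypothesis `π ⟂ σ̄`) [DeitmarEchterhoff2014].
-/

noncomputable section

open MeasureTheory Measure NumberField IsDedekindDomain Matrix Set Filter Topology
open scoped ENNReal NNReal ComplexConjugate InnerProductSpace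

namespace Literature.NumberTheory.Automorphic

open Literature.NumberTheory.GaloisRepresentations (ideleGroup)

-- the automorphic quotient carries the tree's Borel σ-algebra, not Mathlib's quotient σ-algebra
-- (verbatim from `RankinSelbergUnfoldingIdentity`)
attribute [-instance] Quotient.instMeasurableSpace QuotientGroup.measurableSpace

/-! ### Orthogonality kills `∫ φ φ'` -/

section Orthogonality

open AdelicGroupData

variable {n : ℕ} {K : Type} [Field K] [NumberField K]
  {μ : Measure (gl n K).automorphicQuotient} [(gl n K).IsAutomorphicMeasure μ]

/-- **`∫ φ φ' dμ = 0` for cusp forms `φ ∈ π`, `φ' ∈ σ` with `π̄ ⟂ σ`**: the integral is the `L²` inner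
product `⟨φ̄, φ'⟩` (Mathlib `MeasureTheory.L2.inner_def`) and `φ̄ ∈ π̄` (`cuspFormsToLp_star_mem_conj`).
The proof of `integral_mul_eq_zero_of_ne_conj` (`RankinSelbergIntegralNeConjResidue`) with the
orthogonality as hypothesis instead of "`π̄ ≠ σ` + multiplicity one". This is the vanishing of
Cogdell's residue `c Φ̂(0) ∫ φ̃ φ̃'` of the global Rankin–Selberg integrals (Cogdell (2004), §4.2, proof
of Thm. 4.2). [cite: CogdellAnalyticTheory2004, §4.2 (proof of Thm. 4.2)] -/
theorem integral_mul_eq_zero_of_isOrtho_conj (P P' : CuspidalAutomorphicRepGL n K μ)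
    (hor : P.conj.1.toSubmodule ⟂ P'.1.toSubmodule)
    {φ φ' : (gl n K).automorphicQuotient → ℂ} (hφ : φ ∈ cuspForms n K μ)
    (hφ' : φ' ∈ cuspForms n K μ) (hP : cuspFormsToLp n K μ ⟨φ, hφ⟩ ∈ P.1)
    (hP' : cuspFormsToLp n K μ ⟨φ', hφ'⟩ ∈ P'.1) : ∫ x, φ x * φ' x ∂μ = 0 := by
  have hstar : cuspFormsToLp n K μ ⟨star φ, star_mem_cuspForms μ hφ⟩ ∈ P.conj.1 :=
    cuspFormsToLp_star_mem_conj P hφ hP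
  have h0 := (Submodule.isOrtho_iff_inner_eq.1 hor) _ hstar _ hP'
  rw [cuspFormsToLp_apply, cuspFormsToLp_apply, MeasureTheory.L2.inner_def] at h0
  rw [← h0]
  refine integral_congr_ae ?_
  filter_upwards [(memLp_of_mem_cuspForms (star_mem_cuspForms μ hφ)).coeFn_toLp,
    (memLp_of_mem_cuspForms hφ').coeFn_toLp] with x hx hx'
  rw [hx, hx', RCLike.inner_apply, Pi.star_apply, starRingEnd_apply, star_star, mul_comm]

end Orthogonality

/-! ### No pole of the Rankin–Selberg integrals at `s = 1` and `s = 0` for orthogonal pairs -/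

section NoPole

open ValuativeRel

variable {n : ℕ} {K : Type} [Field K] [NumberField K]
variable {μ' : Measure (AdelicGroupData.gl n K).automorphicQuotient} [(AdelicGroupData.gl n K).IsAutomorphicMeasure μ']
variable [MeasurableSpace (AdeleRing (𝓞 K) K)] [BorelSpace (AdeleRing (𝓞 K) K)]

-- the house local instances, exactly as in `RankinSelbergUnfoldingIdentity`
attribute [local instance] adelicBorel borelSpace_adelic locallyCompactSpace_adelic secondCountableTopology_gl_adelic
  glAdeleBorel borelSpace_glAdele borelSpace_ideleGroup secondCountableTopology_ideleGroup

/-- **For `π̄ ⟂ σ` the global Rankin–Selberg integral `I(s; φ, φ', Φ)` (`φ ∈ π`, `φ' ∈ σ`) has no pole at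
`s = 1`**: `(s - 1) I(s; φ, φ', Φ) → 0` as `s → 1`, `Re s > 1` — the residue `c_D V Φ̂(0) / n · ∫ φ φ'`
of `tendsto_sub_one_mul_rankinSelbergIntegral` vanishes by `integral_mul_eq_zero_of_isOrtho_conj`
(Cogdell (2004), §4.2; Jacquet–Shalika II, §3, Prop. 3.6; as `…_of_ne_conj` with orthogonality for
multiplicity one). [cite: CogdellAnalyticTheory2004, §4.2 (proof of Thm. 4.2)] -/
theorem tendsto_sub_one_mul_rankinSelbergIntegral_of_isOrtho_conj
    (ν : Measure (ideleGroup K)) [ν.IsHaarMeasure] [ν.IsMulRightInvariant] (hn : 0 < n)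
    (P P' : CuspidalAutomorphicRepGL n K μ') (hor : P.conj.1.toSubmodule ⟂ P'.1.toSubmodule)
    (μ : Measure (Fin n → AdeleRing (𝓞 K) K)) [μ.IsAddHaarMeasure]
    {Φ : (Fin n → AdeleRing (𝓞 K) K) → ℂ} (hΦ : Φ ∈ piSchwartzBruhat K (Fin n))
    {φ φ' : (AdelicGroupData.gl n K).automorphicQuotient → ℂ} (hφ : φ ∈ cuspForms n K μ')
    (hφ' : φ' ∈ cuspForms n K μ') (hP : cuspFormsToLp n K μ' ⟨φ, hφ⟩ ∈ P.1)
    (hP' : cuspFormsToLp n K μ' ⟨φ', hφ'⟩ ∈ P'.1)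
    (hφd : IsRapidlyDecreasingGL n K (invQuot (AdelicGroupData.gl n K) φ))
    (hφ'd : IsRapidlyDecreasingGL n K (invQuot (AdelicGroupData.gl n K) φ')) :
    Tendsto (fun s => (s - 1) * rankinSelbergIntegral μ' ν Φ s φ φ') (𝓝[{s : ℂ | 1 < s.re}] 1)
      (𝓝 0) := by
  have h := tendsto_sub_one_mul_rankinSelbergIntegral ν hn μ' μ hΦ hφ.1 hφ'.1 hφd hφ'd
  rwa [integral_mul_eq_zero_of_isOrtho_conj P P' hor hφ hφ' hP hP', mul_zero] at h

/-- **The residue at `s = 1` vanishes for orthogonal pairs, entire form.** For cuspidal `π ∋ f`,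
`π' ∋ f'` with `π' ⟂ π`, a test function `η`, `Φ ∈ piSchwartzBruhat` and a Haar measure `ν_I`: every
entire `F` with `F(s) = s (s - 1) I(s; S̄_η f', S_η f, Φ)` for `Re s > 1` has `F(1) = 0` — `F(s) =
s · ((s - 1) I(s)) → 1 · 0` (`tendsto_sub_one_mul_rankinSelbergIntegral_of_isOrtho_conj` for the pair
`(\bar{π'}, π)`: `[S̄_η f'] ∈ \bar{π'}` and `\bar{\bar{π'}} = π' ⟂ π`). The last step of
`exists_entire_eq_mul_rankinSelbergIntegral_star_of_ne` (`PairLFunctionNeConjGlobalRankinSelberg`) with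
orthogonality for multiplicity one. [cite: CogdellAnalyticTheory2004, §4.2 (proof of Thm. 4.2)] -/
theorem apply_one_eq_zero_of_entire_eq_mul_rankinSelbergIntegral_of_isOrtho (hn : 0 < n)
    (νI : Measure (ideleGroup K)) [νI.IsHaarMeasure]
    (P Q : CuspidalAutomorphicRepGL n K μ') (hor : Q.1.toSubmodule ⟂ P.1.toSubmodule)
    (f : P.1.toSubmodule) (f' : Q.1.toSubmodule)
    {η : (AdelicGroupData.gl n K).Adelic → ℝ} (hη : IsTestFunctionGL n K η)
    {Φ : (Fin n → AdeleRing (𝓞 K) K) → ℂ} (hΦ : Φ ∈ piSchwartzBruhat K (Fin n))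
    {F : ℂ → ℂ} (hF : Differentiable ℂ F)
    (hFI : ∀ s : ℂ, 1 < s.re → F s = s * (s - 1) * rankinSelbergIntegral μ' νI Φ s
      (star (smoothedForm η (f' : (AdelicGroupData.gl n K).L2 μ')))
      (smoothedForm η (f : (AdelicGroupData.gl n K).L2 μ'))) :
    F 1 = 0 := by
  classical
  haveI hνIR : νI.IsMulRightInvariant := by
    haveI := isInvInvariant_of_isHaarMeasure_ideleGroup (K := K) νI
    infer_instance
  -- the datum
  set φt : (AdelicGroupData.gl n K).automorphicQuotient → ℂ :=
    smoothedForm η (f : (AdelicGroupData.gl n K).L2 μ') with hφt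
  set φt' : (AdelicGroupData.gl n K).automorphicQuotient → ℂ :=
    smoothedForm η (f' : (AdelicGroupData.gl n K).L2 μ') with hφt'
  have hφd : IsRapidlyDecreasingGL n K (invQuot (AdelicGroupData.gl n K) φt) :=
    isRapidlyDecreasingGL_invQuot_smoothedForm hη (P.2.1 f.2)
  have hφ'd : IsRapidlyDecreasingGL n K (invQuot (AdelicGroupData.gl n K) (star φt')) :=
    isRapidlyDecreasingGL_invQuot_star (isRapidlyDecreasingGL_invQuot_smoothedForm hη (Q.2.1 f'.2))
  -- an additive Haar measure on `𝔸_Kⁿ` (for the residue formula)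
  haveI : T2Space (AdeleRing (𝓞 K) K) := t2Space_adeleRing K
  haveI := secondCountableTopology_adeleRing K
  haveI := locallyCompactSpace_adeleRing' K
  set μA : Measure (Fin n → AdeleRing (𝓞 K) K) := Measure.addHaar with hμA
  -- the residue at `s = 1` vanishes: `[φ̄'] ∈ π̄'`, `[φ] ∈ π`, `\bar{π̄'} = π' ⟂ π`
  have hφm : φt ∈ cuspForms n K μ' := smoothedForm_mem_cuspForms P hη.continuous hη.hasCompactSupport f
  have hφ'm : φt' ∈ cuspForms n K μ' := smoothedForm_mem_cuspForms Q hη.continuous hη.hasCompactSupport f'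
  have hP : cuspFormsToLp n K μ' ⟨φt, hφm⟩ ∈ P.1 :=
    cuspFormsToLp_smoothedForm_mem P hη.continuous hη.hasCompactSupport f
  have hQ' : cuspFormsToLp n K μ' ⟨star φt', star_mem_cuspForms μ' hφ'm⟩ ∈ Q.conj.1 :=
    cuspFormsToLp_star_mem_conj Q hφ'm (cuspFormsToLp_smoothedForm_mem Q hη.continuous hη.hasCompactSupport f')
  have hor' : Q.conj.conj.1.toSubmodule ⟂ P.1.toSubmodule := by
    rw [CuspidalAutomorphicRepGL.conj_conj]; exact hor
  have hres := tendsto_sub_one_mul_rankinSelbergIntegral_of_isOrtho_conj νI hn Q.conj P hor' μA hΦ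
    (star_mem_cuspForms μ' hφ'm) hφm hQ' hP hφ'd hφd
  -- `F(s) = s · ((s - 1) I(s)) → 1 · 0` and `F(s) → F(1)` along `s → 1`, `re s > 1`
  have hF1 : Tendsto F (𝓝[{s : ℂ | 1 < s.re}] 1) (𝓝 (F 1)) :=
    (hF.continuous.tendsto 1).mono_left nhdsWithin_le_nhds
  have hF0 : Tendsto F (𝓝[{s : ℂ | 1 < s.re}] 1) (𝓝 0) := by
    have hid : Tendsto (fun s : ℂ => s) (𝓝[{s : ℂ | 1 < s.re}] 1) (𝓝 1) :=
      tendsto_id.mono_left nhdsWithin_le_nhds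
    have h := hid.mul hres
    rw [one_mul] at h
    refine h.congr' ?_
    filter_upwards [self_mem_nhdsWithin] with s hs
    rw [hFI s hs]
    ring
  exact tendsto_nhds_unique hF1 hF0

/-- **The residue at `s = 0` vanishes for orthogonal pairs** (`f ∈ π`, `f' ∈ π'`, `π' ⟂ π`): every
entire `F` with `F(s) = s (s - 1) I(s; S̄_η f', S_η f, Φ)` for `re s > 1` has `F(0) = 0`. `F` is the
continuation of `RankinSelbergIntegralEntireZero` (uniqueness, `eq_of_differentiable_of_eqOn_one_lt_re`),
whose value at `0` is `V Φ(0)/n · ∫ S̄_η f' S_η f dμ'`, and `∫ S̄_η f' S_η f = 0` because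
`[S̄_η f'] ∈ \bar{π'}`, `[S_η f] ∈ π` and `\bar{\bar{π'}} = π' ⟂ π` (`integral_mul_eq_zero_of_isOrtho_conj`).
The proof of `apply_zero_eq_zero_of_entire_eq_mul_rankinSelbergIntegral_of_ne_conj` with orthogonality
for multiplicity one. Jacquet–Shalika (1981), §4, Lemma 4.2 (the residue of `E(g, Φ; s)` at `s = 0` is
`-V Φ(0)/n`, independent of `g`); Cogdell (2004), §4.2.
[cite: JacquetShalikaAJM1981, §4, Lemma 4.2] [cite: CogdellAnalyticTheory2004, §4.2 (proof of Thm. 4.2)] -/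
theorem apply_zero_eq_zero_of_entire_eq_mul_rankinSelbergIntegral_of_isOrtho (hn : 0 < n)
    (νI : Measure (ideleGroup K)) [νI.IsHaarMeasure]
    (P Q : CuspidalAutomorphicRepGL n K μ') (hor : Q.1.toSubmodule ⟂ P.1.toSubmodule)
    (f : P.1.toSubmodule) (f' : Q.1.toSubmodule)
    {η : (AdelicGroupData.gl n K).Adelic → ℝ} (hη : IsTestFunctionGL n K η)
    {Φ : (Fin n → AdeleRing (𝓞 K) K) → ℂ} (hΦ : Φ ∈ piSchwartzBruhat K (Fin n))
    {F : ℂ → ℂ} (hF : Differentiable ℂ F)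
    (hFI : ∀ s : ℂ, 1 < s.re → F s = s * (s - 1) * rankinSelbergIntegral μ' νI Φ s
      (star (smoothedForm η (f' : (AdelicGroupData.gl n K).L2 μ')))
      (smoothedForm η (f : (AdelicGroupData.gl n K).L2 μ'))) :
    F 0 = 0 := by
  classical
  haveI hνIR : νI.IsMulRightInvariant := by
    haveI := isInvInvariant_of_isHaarMeasure_ideleGroup (K := K) νI
    infer_instance
  -- the datum
  set φt : (AdelicGroupData.gl n K).automorphicQuotient → ℂ :=
    smoothedForm η (f : (AdelicGroupData.gl n K).L2 μ') with hφt
  set φt' : (AdelicGroupData.gl n K).automorphicQuotient → ℂ :=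
    smoothedForm η (f' : (AdelicGroupData.gl n K).L2 μ') with hφt'
  have hφtc : Continuous φt := continuous_smoothedForm hη.continuous hη.hasCompactSupport _
  have hφt'c : Continuous φt' := continuous_smoothedForm hη.continuous hη.hasCompactSupport _
  have hφd : IsRapidlyDecreasingGL n K (invQuot (AdelicGroupData.gl n K) φt) :=
    isRapidlyDecreasingGL_invQuot_smoothedForm hη (P.2.1 f.2)
  have hφ'd : IsRapidlyDecreasingGL n K (invQuot (AdelicGroupData.gl n K) (star φt')) :=
    isRapidlyDecreasingGL_invQuot_star (isRapidlyDecreasingGL_invQuot_smoothedForm hη (Q.2.1 f'.2))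
  -- the explicit continuation and its value at `0`
  obtain ⟨F₀, hF₀, hF₀I, hF₀0⟩ := exists_entire_eq_mul_rankinSelbergIntegral_apply_zero (K := K) νI hn μ' hΦ
    (show Continuous (star φt') from continuous_star.comp hφt'c) hφtc hφ'd hφd
  have hFF₀ : F = F₀ :=
    eq_of_differentiable_of_eqOn_one_lt_re hF hF₀ fun s hs => by rw [hFI s hs, hF₀I s hs]
  -- `∫ φ̄' φ = 0`: `[φ̄'] ∈ π̄'`, `[φ] ∈ π`, `π' ⟂ π`
  have hφm : φt ∈ cuspForms n K μ' := smoothedForm_mem_cuspForms P hη.continuous hη.hasCompactSupport f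
  have hφ'm : φt' ∈ cuspForms n K μ' := smoothedForm_mem_cuspForms Q hη.continuous hη.hasCompactSupport f'
  have hP : cuspFormsToLp n K μ' ⟨φt, hφm⟩ ∈ P.1 :=
    cuspFormsToLp_smoothedForm_mem P hη.continuous hη.hasCompactSupport f
  have hQ' : cuspFormsToLp n K μ' ⟨star φt', star_mem_cuspForms μ' hφ'm⟩ ∈ Q.conj.1 :=
    cuspFormsToLp_star_mem_conj Q hφ'm (cuspFormsToLp_smoothedForm_mem Q hη.continuous hη.hasCompactSupport f')
  have hor' : Q.conj.conj.1.toSubmodule ⟂ P.1.toSubmodule := by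
    rw [CuspidalAutomorphicRepGL.conj_conj]; exact hor
  have h0 : ∫ x, (star φt') x * φt x ∂μ' = 0 :=
    integral_mul_eq_zero_of_isOrtho_conj Q.conj P hor' (star_mem_cuspForms μ' hφ'm) hφm hQ' hP
  rw [hFF₀, hF₀0, h0, mul_zero]

end NoPole

/-! ### The orthogonal-pair continuation from the local theory -/

section LocalReduction

open ValuativeRel

variable {n : ℕ} {K : Type} [Field K] [NumberField K]
variable {μ' : Measure (AdelicGroupData.gl n K).automorphicQuotient} [(AdelicGroupData.gl n K).IsAutomorphicMeasure μ']
variable [MeasurableSpace (AdeleRing (𝓞 K) K)] [BorelSpace (AdeleRing (𝓞 K) K)]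

-- the house local instances, exactly as in `RankinSelbergUnfoldingIdentity`
attribute [local instance] adelicBorel borelSpace_adelic locallyCompactSpace_adelic secondCountableTopology_gl_adelic
  glAdeleBorel borelSpace_glAdele borelSpace_ideleGroup secondCountableTopology_ideleGroup

/-- **`L^S(s, π × σ)` is entire for orthogonal pairs `π ⟂ σ̄`, from the local Rankin–Selberg theory.**
For all cuspidal `π`, `σ` in `L²_cusp(GL_n(𝔸_K), μ')` (`n ≥ 1`) with `π ⟂ σ̄`, every finite `S` and
Satake families `α`, `β` off `S`, the partial `L`-function `L^S(s, π ⊗ σ)` extends to an entire function —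
granted the two inputs `hloc` (the local theory for the pairs with a common central action `hω`: finitely
many data whose normalised `S'`-parts sum, on the strip, to a function with an ENTIRE reciprocal `B`)
and `htw` (the conclusion for the pairs without a common central action), both stated exactly as in
`MoeglinWaldspurger1989_partialPairL_entire_of_ne_conj_of_local` EXCEPT that their binder
`multiplicity_one_gl n K μ'` is replaced by the orthogonality `P.1.toSubmodule ⟂ P'.conj.1.toSubmodule`.
Proof: that of `…_of_local` verbatim — the global theorem
`exists_entire_eq_mul_partialPairL_mul_setIntegral_pair` supplies entire `F_i = s (s - 1) I(s; ·)`,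
factorised on the strip; both residues vanish by orthogonality
(`apply_one_eq_zero_…_of_isOrtho`, `apply_zero_eq_zero_…_of_isOrtho`); `G = C⁻¹ B ∑ c_i F_i` is entire,
vanishes at `0`, `1` and equals `s (s - 1) L^{S₀}` on the strip, hence on `re s > 1`; the removable-poles
lemma gives the continuation off the joint ramified set `S₀`, and the change-of-`S` bookkeeping
`exists_entire_eq_partialPairL_of_ramified_datum` gives it off every admissible `S`.
[cite: MoeglinWaldspurger1989, Appendice, Corollaire (i)(b), p. 667] [cite: CogdellAnalyticTheory2004, §4.2 (proof of Thm. 4.2)] -/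
theorem partialPairL_entire_of_isOrtho_conj_of_local
    (νI : Measure (ideleGroup K)) [νI.IsHaarMeasure]
    (νA : Measure (Fin n → ideleGroup K)) [IsHaarMeasure νA]
    (νK : Measure ↥(maximalCompactAdelic n K)) [IsHaarMeasure νK]
    (ν₀ : Measure ↥(adelicUnipotent n K)) [IsHaarMeasure ν₀]
    (hloc : ∀ (_hn : 0 < n)
      (P P' : CuspidalAutomorphicRepGL n K μ') (_hne : P ≠ P'.conj)
      (_hor : P.1.toSubmodule ⟂ P'.conj.1.toSubmodule)
      (_hω : (∀ z : ideleGroup K, ∃ c : ℂ, ‖c‖ = 1 ∧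
        (∀ f : P.1.toSubmodule,
          (AdelicGroupData.gl n K).rightRegular μ' (Matrix.GeneralLinearGroup.scalar (Fin n) z)
              (f : (AdelicGroupData.gl n K).L2 μ') = c • (f : (AdelicGroupData.gl n K).L2 μ')) ∧
        (∀ f' : P'.conj.1.toSubmodule,
          (AdelicGroupData.gl n K).rightRegular μ' (Matrix.GeneralLinearGroup.scalar (Fin n) z)
              (f' : (AdelicGroupData.gl n K).L2 μ') = c • (f' : (AdelicGroupData.gl n K).L2 μ'))))
      {S₀ : Set (HeightOneSpectrum (𝓞 K))} (_hS₀ : S₀.Finite) {α β : SatakeFamily K}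
      (_hα : IsSatakeFamilyOf P S₀ α) (_hβ : IsSatakeFamilyOf P' S₀ β),
      ∃ (m : ℕ) (c : Fin m → ℂ) (f : Fin m → P.1.toSubmodule) (f' : Fin m → P'.conj.1.toSubmodule)
        (𝔫₀ : Fin m → Ideal (𝓞 K)) (_h𝔫₀ : ∀ i, 𝔫₀ i ≠ 0)
        (η : Fin m → (AdelicGroupData.gl n K).Adelic → ℝ) (_hη : ∀ i, IsTestFunctionGL n K (η i))
        (_hηK : ∀ i, ∀ k : (AdelicGroupData.gl n K).Adelic, k ∈ principalCongruenceLevel n K (𝔫₀ i) →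
          ∀ g : (AdelicGroupData.gl n K).Adelic, η i (k * g) = η i g)
        (S' : Fin m → Set (HeightOneSpectrum (𝓞 K))) (hS'f : ∀ i, (S' i \ S₀).Finite) (_hS₀S' : ∀ i, S₀ ⊆ S' i)
        (_hS' : ∀ i, ∀ v ∉ S' i, ¬ v.asIdeal ∣ 𝔫₀ i ∧ ¬ v.asIdeal ∣ differentIdeal ℤ (𝓞 K))
        (x y : Fin m → HeightOneSpectrum (𝓞 K) → Fin n → ℂ)
        (_hx : ∀ i, ∀ v ∉ S' i, (Finset.univ : Finset (Fin n)).val.map (x i v) = α v)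
        (_hy : ∀ i, ∀ v ∉ S' i, (Finset.univ : Finset (Fin n)).val.map (y i v) = (β v).map conj)
        (Φinf : Fin m → (Fin n → InfiniteAdeleRing K) → ℝ) (_hΦc : ∀ i, Continuous (Φinf i))
        (_hΦ0 : ∀ i, ∀ z, 0 ≤ Φinf i z)
        (_hΦS : ∀ i, (fun v => ((standardTestFun n K (Φinf i) v : ℝ) : ℂ)) ∈ piSchwartzBruhat K (Fin n))
        (B : ℂ → ℂ), Differentiable ℂ B ∧
          ∀ s : ℂ, 1 < s.re → s.re < 2 →
            B s * (∑ i, c i * ((∏ v ∈ (hS'f i).toFinset,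
                (satakePairPolynomial (α v) (β v)).eval ((v.residueCard : ℂ) ^ (-s))) *
              ∫ p in unitBox {v | v ∉ S' i} ×ˢ Set.univ, torusPairIntegrandC n K
                (whittakerCoeff ν₀ (unipotentTateDomain n K) (adeleAddChar K)
                  (invQuot (AdelicGroupData.gl n K) (smoothedForm (η i) ((f i : P.1.toSubmodule) : (AdelicGroupData.gl n K).L2 μ'))))
                (star (whittakerCoeff ν₀ (unipotentTateDomain n K) (adeleAddChar K)
                  (invQuot (AdelicGroupData.gl n K) (smoothedForm (η i) ((f' i : P'.conj.1.toSubmodule) : (AdelicGroupData.gl n K).L2 μ')))))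
                (standardTestFun n K (Φinf i)) s p ∂(νA.prod νK))) = 1)
    (htw : ∀ (_hn : 0 < n)
      (P P' : CuspidalAutomorphicRepGL n K μ') (_hne : P ≠ P'.conj)
      (_hor : P.1.toSubmodule ⟂ P'.conj.1.toSubmodule)
      (_hω : ¬ (∀ z : ideleGroup K, ∃ c : ℂ, ‖c‖ = 1 ∧
        (∀ f : P.1.toSubmodule,
          (AdelicGroupData.gl n K).rightRegular μ' (Matrix.GeneralLinearGroup.scalar (Fin n) z)
              (f : (AdelicGroupData.gl n K).L2 μ') = c • (f : (AdelicGroupData.gl n K).L2 μ')) ∧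
        (∀ f' : P'.conj.1.toSubmodule,
          (AdelicGroupData.gl n K).rightRegular μ' (Matrix.GeneralLinearGroup.scalar (Fin n) z)
              (f' : (AdelicGroupData.gl n K).L2 μ') = c • (f' : (AdelicGroupData.gl n K).L2 μ'))))
      {S₀ : Set (HeightOneSpectrum (𝓞 K))} (_hS₀ : S₀.Finite) {α β : SatakeFamily K}
      (_hα : IsSatakeFamilyOf P S₀ α) (_hβ : IsSatakeFamilyOf P' S₀ β),
      ∃ g : ℂ → ℂ, Differentiable ℂ g ∧ ∀ s : ℂ, 1 < s.re → g s = partialPairL S₀ α β s)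
    :
    ∀ (_hn : 0 < n) (P P' : CuspidalAutomorphicRepGL n K μ') (_hor : P.1.toSubmodule ⟂ P'.conj.1.toSubmodule)
      {S : Set (HeightOneSpectrum (𝓞 K))} (_hS : S.Finite) {α β : SatakeFamily K}
      (_hα : IsSatakeFamilyOf P S α) (_hβ : IsSatakeFamilyOf P' S β),
      ∃ g : ℂ → ℂ, Differentiable ℂ g ∧ ∀ s : ℂ, 1 < s.re → g s = partialPairL S α β s := by
  classical
  intro hn P P' hor S hS α β hα hβ
  -- orthogonal representations are distinct (`π` is non-zero, hence not orthogonal to itself)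
  have hne : P ≠ P'.conj := by
    intro h
    have hPbot : P.1 ≠ ⊥ := ((P.1.isTopIrreducible_toContRep_iff).1 P.isTopIrreducible).1
    obtain ⟨g, hg, hg0⟩ : ∃ g ∈ P.1.toSubmodule, g ≠ 0 := by
      by_contra hall
      push Not at hall
      exact hPbot (le_bot_iff.1 fun g hg => by
        rw [ContRepresentation.ClosedSubrep.mem_bot]; exact hall g hg)
    have h0 : ⟪g, g⟫_ℂ = 0 := (Submodule.isOrtho_iff_inner_eq.1 hor) g hg g (by rw [← h]; exact hg)
    exact hg0 (inner_self_eq_zero.1 h0)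
  -- reduction to the ramified datum (change of `S`, uniqueness of Satake parameters)
  obtain ⟨α₀, β₀, hα₀, hβ₀⟩ := exists_isSatakeFamilyOf_pair_ramified P P'
  have hS₀ : {v : HeightOneSpectrum (𝓞 K) | ¬ IsUnramifiedAt P.1 v ∨ ¬ IsUnramifiedAt P'.1 v}.Finite :=
    finite_setOf_not_isUnramifiedAt_or P P'
  set S₀ : Set (HeightOneSpectrum (𝓞 K)) := {v | ¬ IsUnramifiedAt P.1 v ∨ ¬ IsUnramifiedAt P'.1 v} with hS₀def
  refine exists_entire_eq_partialPairL_of_ramified_datum P P' (S₀ := S₀) (fun v hv => hv) hα₀ hβ₀ ?_ hS hα hβ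
  -- pairs without a common central action: the twisted input
  by_cases hω : (∀ z : ideleGroup K, ∃ c : ℂ, ‖c‖ = 1 ∧
        (∀ f : P.1.toSubmodule,
          (AdelicGroupData.gl n K).rightRegular μ' (Matrix.GeneralLinearGroup.scalar (Fin n) z)
              (f : (AdelicGroupData.gl n K).L2 μ') = c • (f : (AdelicGroupData.gl n K).L2 μ')) ∧
        (∀ f' : P'.conj.1.toSubmodule,
          (AdelicGroupData.gl n K).rightRegular μ' (Matrix.GeneralLinearGroup.scalar (Fin n) z)
              (f' : (AdelicGroupData.gl n K).L2 μ') = c • (f' : (AdelicGroupData.gl n K).L2 μ')))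
  swap
  · exact htw hn P P' hne hor hω hS₀ hα₀ hβ₀
  -- the global theorem and the local data
  obtain ⟨C, hC, hT⟩ := exists_entire_eq_mul_partialPairL_mul_setIntegral_pair (n := n) (K := K) hn μ' νI νA νK ν₀
  obtain ⟨m, c, f, f', 𝔫₀, h𝔫₀, η, hη, hηK, S', hS'f, hS₀S', hS', x, y, hx, hy, Φinf, hΦc, hΦ0, hΦS, B, hB,
    hBsum⟩ := hloc hn P P' hne hor hω hS₀ hα₀ hβ₀
  have hZ : ∀ (i : Fin m) (z : ideleGroup K), ∃ c : ℂ, ‖c‖ = 1 ∧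
      (AdelicGroupData.gl n K).rightRegular μ' (Matrix.GeneralLinearGroup.scalar (Fin n) z)
          ((f i : P.1.toSubmodule) : (AdelicGroupData.gl n K).L2 μ') =
        c • ((f i : P.1.toSubmodule) : (AdelicGroupData.gl n K).L2 μ') ∧
      (AdelicGroupData.gl n K).rightRegular μ' (Matrix.GeneralLinearGroup.scalar (Fin n) z)
          ((f' i : P'.conj.1.toSubmodule) : (AdelicGroupData.gl n K).L2 μ') =
        c • ((f' i : P'.conj.1.toSubmodule) : (AdelicGroupData.gl n K).L2 μ') := fun i z => by
    obtain ⟨d, hd, hP, hQ⟩ := hω z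
    exact ⟨d, hd, hP (f i), hQ (f' i)⟩
  choose F hF hFI hFstrip _hF1 using fun i : Fin m =>
    hT P P'.conj (f i) (f' i) (hZ i) hα₀ hβ₀.conj (h𝔫₀ i) (hη i) (hηK i) (hS₀S' i) (hS' i) (hx i) (hy i)
      (hΦc i) (hΦ0 i) (hΦS i)
  -- the residues of every `F_i` at `s = 1` and `s = 0`
  have hF1' : ∀ i, F i 1 = 0 := fun i =>
    apply_one_eq_zero_of_entire_eq_mul_rankinSelbergIntegral_of_isOrtho hn νI P P'.conj hor.symm (f i) (f' i)
      (hη i) (hΦS i) (hF i) (hFI i)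
  have hF0' : ∀ i, F i 0 = 0 := fun i =>
    apply_zero_eq_zero_of_entire_eq_mul_rankinSelbergIntegral_of_isOrtho hn νI P P'.conj hor.symm (f i) (f' i)
      (hη i) (hΦS i) (hF i) (hFI i)
  -- `∑ c_i F_i = s (s - 1) · C · L^{S₀} · ∑ c_i A_i` on the strip
  have hββ : (fun v => ((β₀ v).map conj).map conj) = β₀ := funext fun v => multiset_map_conj_map_conj _
  have hmul : ∀ (i : Fin m) (s : ℂ), 1 < s.re → Multipliable fun v : {v : HeightOneSpectrum (𝓞 K) // v ∉ S' i} =>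
      ((satakePairPolynomial (α₀ v.1) (β₀ v.1)).eval ((v.1.residueCard : ℂ) ^ (-s)))⁻¹ := fun i s hs =>
    JacquetShalika1981_multipliable_partialPairL_holds P P' (hα₀.mono (hS₀S' i)) (hβ₀.mono (hS₀S' i)) hs
  have hPne : ∀ (i : Fin m) (s : ℂ), 1 < s.re → ∀ v ∈ (hS'f i).toFinset,
      (satakePairPolynomial (α₀ v) (β₀ v)).eval ((v.residueCard : ℂ) ^ (-s)) ≠ 0 := fun i s hs v hv =>
    eval_satakePairPolynomial_ne_zero_of_one_lt_re P P' hα₀ hβ₀ ((hS'f i).mem_toFinset.1 hv).2 hs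
  have hsum : ∀ s : ℂ, 1 < s.re → s.re < 2 →
      ∑ i, c i * F i s = (s * (s - 1) * (C : ℂ) * partialPairL S₀ α₀ β₀ s) *
        ∑ i, c i * ((∏ v ∈ (hS'f i).toFinset,
                (satakePairPolynomial (α₀ v) (β₀ v)).eval ((v.residueCard : ℂ) ^ (-s))) *
              ∫ p in unitBox {v | v ∉ S' i} ×ˢ Set.univ, torusPairIntegrandC n K
                (whittakerCoeff ν₀ (unipotentTateDomain n K) (adeleAddChar K)
                  (invQuot (AdelicGroupData.gl n K) (smoothedForm (η i) ((f i : P.1.toSubmodule) : (AdelicGroupData.gl n K).L2 μ'))))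
                (star (whittakerCoeff ν₀ (unipotentTateDomain n K) (adeleAddChar K)
                  (invQuot (AdelicGroupData.gl n K) (smoothedForm (η i) ((f' i : P'.conj.1.toSubmodule) : (AdelicGroupData.gl n K).L2 μ')))))
                (standardTestFun n K (Φinf i)) s p ∂(νA.prod νK)) := by
    intro s hs1 hs2
    rw [Finset.mul_sum]
    refine Finset.sum_congr rfl fun i _ => ?_
    have h := hFstrip i s hs1 hs2
    beta_reduce at h
    rw [hββ] at h
    have hP0 : (∏ v ∈ (hS'f i).toFinset,
                (satakePairPolynomial (α₀ v) (β₀ v)).eval ((v.residueCard : ℂ) ^ (-s))) ≠ 0 :=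
      Finset.prod_ne_zero_iff.2 (hPne i s hs1)
    rw [h, partialPairL_eq_prod_mul_partialPairL (hS₀S' i) (hS'f i) α₀ β₀ (hmul i s hs1), Finset.prod_inv_distrib]
    field_simp
  -- the entire function `G = C⁻¹ B ∑ c_i F_i`
  set G : ℂ → ℂ := fun s => (C : ℂ)⁻¹ * (B s * ∑ i, c i * F i s) with hGdef
  have hC0 : (C : ℂ) ≠ 0 := Complex.ofReal_ne_zero.2 hC.ne'
  have hsumF : Differentiable ℂ fun s => ∑ i, c i * F i s := by
    have h : Differentiable ℂ (∑ i, fun s => c i * F i s) := Differentiable.sum fun i _ => (hF i).const_mul (c i)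
    convert h using 1
    funext s
    simp only [Finset.sum_apply]
  have hG : Differentiable ℂ G := by
    show Differentiable ℂ fun s => (C : ℂ)⁻¹ * (B s * ∑ i, c i * F i s)
    exact (hB.mul hsumF).const_mul _
  have hGstrip : ∀ s : ℂ, 1 < s.re → s.re < 2 → G s = s * (s - 1) * partialPairL S₀ α₀ β₀ s := by
    intro s hs1 hs2
    have h1 := hBsum s hs1 hs2
    show (C : ℂ)⁻¹ * (B s * ∑ i, c i * F i s) = _
    rw [hsum s hs1 hs2, mul_left_comm (B s), h1, mul_one]
    field_simp
  have hGL : ∀ s : ℂ, 1 < s.re → G s = s * (s - 1) * partialPairL S₀ α₀ β₀ s :=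
    eq_mul_partialPairL_of_eqOn_strip P P' hα₀ hβ₀ hG (differentiable_id.mul (differentiable_id.sub_const 1)) hGstrip
  have hG1 : G 1 = 0 := by
    show (C : ℂ)⁻¹ * (B 1 * ∑ i, c i * F i 1) = 0
    rw [Finset.sum_eq_zero fun i _ => by rw [hF1' i, mul_zero], mul_zero, mul_zero]
  have hG0 : G 0 = 0 := by
    show (C : ℂ)⁻¹ * (B 0 * ∑ i, c i * F i 0) = 0
    rw [Finset.sum_eq_zero fun i _ => by rw [hF0' i, mul_zero], mul_zero, mul_zero]
  exact exists_entire_eq_of_entire_mul_of_apply_eq_zero hG hG0 hG1 hGL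

/-- **The orthogonal form implies the earlier one**: from `hloc`, `htw` in the orthogonal form, the named
fact `MoeglinWaldspurger1989_partialPairL_entire_of_ne_conj` follows (its binders — multiplicity one and
`P ≠ P'.conj` — give the orthogonality, `CuspidalAutomorphicRepGL.isOrtho_of_ne`).
[cite: MoeglinWaldspurger1989, Appendice, Corollaire (i)(b), p. 667] -/
theorem MoeglinWaldspurger1989_partialPairL_entire_of_ne_conj_of_local_of_isOrtho
    (νI : Measure (ideleGroup K)) [νI.IsHaarMeasure]
    (νA : Measure (Fin n → ideleGroup K)) [IsHaarMeasure νA]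
    (νK : Measure ↥(maximalCompactAdelic n K)) [IsHaarMeasure νK]
    (ν₀ : Measure ↥(adelicUnipotent n K)) [IsHaarMeasure ν₀]
    (hloc : ∀ (_hn : 0 < n)
      (P P' : CuspidalAutomorphicRepGL n K μ') (_hne : P ≠ P'.conj)
      (_hor : P.1.toSubmodule ⟂ P'.conj.1.toSubmodule)
      (_hω : (∀ z : ideleGroup K, ∃ c : ℂ, ‖c‖ = 1 ∧
        (∀ f : P.1.toSubmodule,
          (AdelicGroupData.gl n K).rightRegular μ' (Matrix.GeneralLinearGroup.scalar (Fin n) z)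
              (f : (AdelicGroupData.gl n K).L2 μ') = c • (f : (AdelicGroupData.gl n K).L2 μ')) ∧
        (∀ f' : P'.conj.1.toSubmodule,
          (AdelicGroupData.gl n K).rightRegular μ' (Matrix.GeneralLinearGroup.scalar (Fin n) z)
              (f' : (AdelicGroupData.gl n K).L2 μ') = c • (f' : (AdelicGroupData.gl n K).L2 μ'))))
      {S₀ : Set (HeightOneSpectrum (𝓞 K))} (_hS₀ : S₀.Finite) {α β : SatakeFamily K}
      (_hα : IsSatakeFamilyOf P S₀ α) (_hβ : IsSatakeFamilyOf P' S₀ β),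
      ∃ (m : ℕ) (c : Fin m → ℂ) (f : Fin m → P.1.toSubmodule) (f' : Fin m → P'.conj.1.toSubmodule)
        (𝔫₀ : Fin m → Ideal (𝓞 K)) (_h𝔫₀ : ∀ i, 𝔫₀ i ≠ 0)
        (η : Fin m → (AdelicGroupData.gl n K).Adelic → ℝ) (_hη : ∀ i, IsTestFunctionGL n K (η i))
        (_hηK : ∀ i, ∀ k : (AdelicGroupData.gl n K).Adelic, k ∈ principalCongruenceLevel n K (𝔫₀ i) →
          ∀ g : (AdelicGroupData.gl n K).Adelic, η i (k * g) = η i g)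
        (S' : Fin m → Set (HeightOneSpectrum (𝓞 K))) (hS'f : ∀ i, (S' i \ S₀).Finite) (_hS₀S' : ∀ i, S₀ ⊆ S' i)
        (_hS' : ∀ i, ∀ v ∉ S' i, ¬ v.asIdeal ∣ 𝔫₀ i ∧ ¬ v.asIdeal ∣ differentIdeal ℤ (𝓞 K))
        (x y : Fin m → HeightOneSpectrum (𝓞 K) → Fin n → ℂ)
        (_hx : ∀ i, ∀ v ∉ S' i, (Finset.univ : Finset (Fin n)).val.map (x i v) = α v)
        (_hy : ∀ i, ∀ v ∉ S' i, (Finset.univ : Finset (Fin n)).val.map (y i v) = (β v).map conj)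
        (Φinf : Fin m → (Fin n → InfiniteAdeleRing K) → ℝ) (_hΦc : ∀ i, Continuous (Φinf i))
        (_hΦ0 : ∀ i, ∀ z, 0 ≤ Φinf i z)
        (_hΦS : ∀ i, (fun v => ((standardTestFun n K (Φinf i) v : ℝ) : ℂ)) ∈ piSchwartzBruhat K (Fin n))
        (B : ℂ → ℂ), Differentiable ℂ B ∧
          ∀ s : ℂ, 1 < s.re → s.re < 2 →
            B s * (∑ i, c i * ((∏ v ∈ (hS'f i).toFinset,
                (satakePairPolynomial (α v) (β v)).eval ((v.residueCard : ℂ) ^ (-s))) *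
              ∫ p in unitBox {v | v ∉ S' i} ×ˢ Set.univ, torusPairIntegrandC n K
                (whittakerCoeff ν₀ (unipotentTateDomain n K) (adeleAddChar K)
                  (invQuot (AdelicGroupData.gl n K) (smoothedForm (η i) ((f i : P.1.toSubmodule) : (AdelicGroupData.gl n K).L2 μ'))))
                (star (whittakerCoeff ν₀ (unipotentTateDomain n K) (adeleAddChar K)
                  (invQuot (AdelicGroupData.gl n K) (smoothedForm (η i) ((f' i : P'.conj.1.toSubmodule) : (AdelicGroupData.gl n K).L2 μ')))))
                (standardTestFun n K (Φinf i)) s p ∂(νA.prod νK))) = 1)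
    (htw : ∀ (_hn : 0 < n)
      (P P' : CuspidalAutomorphicRepGL n K μ') (_hne : P ≠ P'.conj)
      (_hor : P.1.toSubmodule ⟂ P'.conj.1.toSubmodule)
      (_hω : ¬ (∀ z : ideleGroup K, ∃ c : ℂ, ‖c‖ = 1 ∧
        (∀ f : P.1.toSubmodule,
          (AdelicGroupData.gl n K).rightRegular μ' (Matrix.GeneralLinearGroup.scalar (Fin n) z)
              (f : (AdelicGroupData.gl n K).L2 μ') = c • (f : (AdelicGroupData.gl n K).L2 μ')) ∧
        (∀ f' : P'.conj.1.toSubmodule,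
          (AdelicGroupData.gl n K).rightRegular μ' (Matrix.GeneralLinearGroup.scalar (Fin n) z)
              (f' : (AdelicGroupData.gl n K).L2 μ') = c • (f' : (AdelicGroupData.gl n K).L2 μ'))))
      {S₀ : Set (HeightOneSpectrum (𝓞 K))} (_hS₀ : S₀.Finite) {α β : SatakeFamily K}
      (_hα : IsSatakeFamilyOf P S₀ α) (_hβ : IsSatakeFamilyOf P' S₀ β),
      ∃ g : ℂ → ℂ, Differentiable ℂ g ∧ ∀ s : ℂ, 1 < s.re → g s = partialPairL S₀ α β s)
    :
    MoeglinWaldspurger1989_partialPairL_entire_of_ne_conj (n := n) (K := K) (μ := μ') :=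
  fun hn h₁ P P' hne _S hS _α _β hα hβ =>
    partialPairL_entire_of_isOrtho_conj_of_local νI νA νK ν₀ hloc htw hn P P'
      (CuspidalAutomorphicRepGL.isOrtho_of_ne h₁ hne) hS hα hβ

/-- **The same with the Haar measures chosen inside** (any choice will do; the local datum `hloc` is
asked for all Haar measures `νA`, `νK`, `ν₀`, as in `MoeglinWaldspurger1989_partialPairL_of_eq_conj_of_local`
of `PairLFunctionMeromorphicContinuationLocalReduction`; `ν_I` from `exists_isHaarMeasure_ideleGroup`).
This is the form consumed by the assembly of Arthur–Clozel (2.2) for Borel–Jacquet data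
(`JacquetShalika1981_partialPairL_boundary_repData_of_moeglinWaldspurger_of_isOrtho`, input `(hB)`), at a
fixed Borel structure on `𝔸_K` (e.g. `borel _`).
[cite: MoeglinWaldspurger1989, Appendice, Corollaire (i)(b), p. 667] -/
theorem partialPairL_entire_of_isOrtho_conj_of_local'
    (hloc : ∀ (νA : Measure (Fin n → ideleGroup K)) [IsHaarMeasure νA]
      (νK : Measure ↥(maximalCompactAdelic n K)) [IsHaarMeasure νK]
      (ν₀ : Measure ↥(adelicUnipotent n K)) [IsHaarMeasure ν₀] (_hn : 0 < n)
      (P P' : CuspidalAutomorphicRepGL n K μ') (_hne : P ≠ P'.conj)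
      (_hor : P.1.toSubmodule ⟂ P'.conj.1.toSubmodule)
      (_hω : (∀ z : ideleGroup K, ∃ c : ℂ, ‖c‖ = 1 ∧
        (∀ f : P.1.toSubmodule,
          (AdelicGroupData.gl n K).rightRegular μ' (Matrix.GeneralLinearGroup.scalar (Fin n) z)
              (f : (AdelicGroupData.gl n K).L2 μ') = c • (f : (AdelicGroupData.gl n K).L2 μ')) ∧
        (∀ f' : P'.conj.1.toSubmodule,
          (AdelicGroupData.gl n K).rightRegular μ' (Matrix.GeneralLinearGroup.scalar (Fin n) z)
              (f' : (AdelicGroupData.gl n K).L2 μ') = c • (f' : (AdelicGroupData.gl n K).L2 μ'))))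
      {S₀ : Set (HeightOneSpectrum (𝓞 K))} (_hS₀ : S₀.Finite) {α β : SatakeFamily K}
      (_hα : IsSatakeFamilyOf P S₀ α) (_hβ : IsSatakeFamilyOf P' S₀ β),
      ∃ (m : ℕ) (c : Fin m → ℂ) (f : Fin m → P.1.toSubmodule) (f' : Fin m → P'.conj.1.toSubmodule)
        (𝔫₀ : Fin m → Ideal (𝓞 K)) (_h𝔫₀ : ∀ i, 𝔫₀ i ≠ 0)
        (η : Fin m → (AdelicGroupData.gl n K).Adelic → ℝ) (_hη : ∀ i, IsTestFunctionGL n K (η i))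
        (_hηK : ∀ i, ∀ k : (AdelicGroupData.gl n K).Adelic, k ∈ principalCongruenceLevel n K (𝔫₀ i) →
          ∀ g : (AdelicGroupData.gl n K).Adelic, η i (k * g) = η i g)
        (S' : Fin m → Set (HeightOneSpectrum (𝓞 K))) (hS'f : ∀ i, (S' i \ S₀).Finite) (_hS₀S' : ∀ i, S₀ ⊆ S' i)
        (_hS' : ∀ i, ∀ v ∉ S' i, ¬ v.asIdeal ∣ 𝔫₀ i ∧ ¬ v.asIdeal ∣ differentIdeal ℤ (𝓞 K))
        (x y : Fin m → HeightOneSpectrum (𝓞 K) → Fin n → ℂ)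
        (_hx : ∀ i, ∀ v ∉ S' i, (Finset.univ : Finset (Fin n)).val.map (x i v) = α v)
        (_hy : ∀ i, ∀ v ∉ S' i, (Finset.univ : Finset (Fin n)).val.map (y i v) = (β v).map conj)
        (Φinf : Fin m → (Fin n → InfiniteAdeleRing K) → ℝ) (_hΦc : ∀ i, Continuous (Φinf i))
        (_hΦ0 : ∀ i, ∀ z, 0 ≤ Φinf i z)
        (_hΦS : ∀ i, (fun v => ((standardTestFun n K (Φinf i) v : ℝ) : ℂ)) ∈ piSchwartzBruhat K (Fin n))
        (B : ℂ → ℂ), Differentiable ℂ B ∧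
          ∀ s : ℂ, 1 < s.re → s.re < 2 →
            B s * (∑ i, c i * ((∏ v ∈ (hS'f i).toFinset,
                (satakePairPolynomial (α v) (β v)).eval ((v.residueCard : ℂ) ^ (-s))) *
              ∫ p in unitBox {v | v ∉ S' i} ×ˢ Set.univ, torusPairIntegrandC n K
                (whittakerCoeff ν₀ (unipotentTateDomain n K) (adeleAddChar K)
                  (invQuot (AdelicGroupData.gl n K) (smoothedForm (η i) ((f i : P.1.toSubmodule) : (AdelicGroupData.gl n K).L2 μ'))))
                (star (whittakerCoeff ν₀ (unipotentTateDomain n K) (adeleAddChar K)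
                  (invQuot (AdelicGroupData.gl n K) (smoothedForm (η i) ((f' i : P'.conj.1.toSubmodule) : (AdelicGroupData.gl n K).L2 μ')))))
                (standardTestFun n K (Φinf i)) s p ∂(νA.prod νK))) = 1)
    (htw : ∀ (_hn : 0 < n)
      (P P' : CuspidalAutomorphicRepGL n K μ') (_hne : P ≠ P'.conj)
      (_hor : P.1.toSubmodule ⟂ P'.conj.1.toSubmodule)
      (_hω : ¬ (∀ z : ideleGroup K, ∃ c : ℂ, ‖c‖ = 1 ∧
        (∀ f : P.1.toSubmodule,
          (AdelicGroupData.gl n K).rightRegular μ' (Matrix.GeneralLinearGroup.scalar (Fin n) z)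
              (f : (AdelicGroupData.gl n K).L2 μ') = c • (f : (AdelicGroupData.gl n K).L2 μ')) ∧
        (∀ f' : P'.conj.1.toSubmodule,
          (AdelicGroupData.gl n K).rightRegular μ' (Matrix.GeneralLinearGroup.scalar (Fin n) z)
              (f' : (AdelicGroupData.gl n K).L2 μ') = c • (f' : (AdelicGroupData.gl n K).L2 μ'))))
      {S₀ : Set (HeightOneSpectrum (𝓞 K))} (_hS₀ : S₀.Finite) {α β : SatakeFamily K}
      (_hα : IsSatakeFamilyOf P S₀ α) (_hβ : IsSatakeFamilyOf P' S₀ β),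
      ∃ g : ℂ → ℂ, Differentiable ℂ g ∧ ∀ s : ℂ, 1 < s.re → g s = partialPairL S₀ α β s)
    :
    ∀ (_hn : 0 < n) (P P' : CuspidalAutomorphicRepGL n K μ') (_hor : P.1.toSubmodule ⟂ P'.conj.1.toSubmodule)
      {S : Set (HeightOneSpectrum (𝓞 K))} (_hS : S.Finite) {α β : SatakeFamily K}
      (_hα : IsSatakeFamilyOf P S α) (_hβ : IsSatakeFamilyOf P' S β),
      ∃ g : ℂ → ℂ, Differentiable ℂ g ∧ ∀ s : ℂ, 1 < s.re → g s = partialPairL S α β s := by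
  classical
  -- topological and measurable structures (as in `MoeglinWaldspurger1989_partialPairL_of_eq_conj_of_local`)
  haveI : T2Space (GL (Fin n) (AdeleRing (𝓞 K) K)) := t2Space_gl n K
  haveI : LocallyCompactSpace (GL (Fin n) (AdeleRing (𝓞 K) K)) :=
    AdelicGroupData.locallyCompactSpace_generalLinearGroup_adeleRing K (Fin n)
  haveI := secondCountableTopology_generalLinearGroup_adeleRing K (Fin n)
  haveI : T2Space (AdeleRing (𝓞 K) K) := t2Space_adeleRing K
  haveI := locallyCompactSpace_ideleGroup K
  haveI := secondCountableTopology_adeleRing K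
  haveI := locallyCompactSpace_adeleRing' K
  haveI : CompactSpace ↥(maximalCompactAdelic n K) :=
    isCompact_iff_compactSpace.1 (isCompact_maximalCompactAdelic n K)
  haveI : LocallyCompactSpace ↥(adelicUnipotent n K) := (isClosed_adelicUnipotent n K).locallyCompactSpace
  -- Haar measures
  obtain ⟨νI, hνI⟩ := exists_isHaarMeasure_ideleGroup K
  set νA : Measure (Fin n → ideleGroup K) := Measure.haar with hνA
  set νK : Measure ↥(maximalCompactAdelic n K) := Measure.haar with hνK
  set ν₀ : Measure ↥(adelicUnipotent n K) := Measure.haar with hν₀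
  exact partialPairL_entire_of_isOrtho_conj_of_local νI νA νK ν₀ (hloc νA νK ν₀) htw

end LocalReduction

end Literature.NumberTheory.Automorphic
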